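import Summits.Ventures.HodgeRepro.Night4ReducedDimSix
import Summits.Ventures.HodgeRepro.TransportPrimitive
import Summits.Ventures.HodgeRepro.FaceCriterion

/-!
# `dim B_red = 4` for EVERY face of EVERY degree-6 type datum — the count of ROUTE.md §3.2 on the kernel, in general

Blind re-derivation cell `pub-hodge-repro`, seat `night-4` (ROUTE HARDENING for the Monday FINAL, gen 1).  Target tree path
`lean/Summits/Ventures/HodgeRepro/Night4ReducedDimTransport.lean`.

`Night4ReducedDimSix.lean` proves `redDim (faceCorners cc_C6 Φ p p') = 4` for the census faces of the explicit group
`C6`.  This file lifts that to the roster's faces of an ABSTRACT type datum of degree 6 (`TypeDatum.redDim_eq_four`):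

* transport of `rclass`, `simpleDim`, `redDim`, `place`, `flipAt`, `faceCorners` along a group isomorphism `e : G ≃* G'`
  (on top of the typer's `Transport.lean` / `TransportPrimitive.lean`: `mapSet`, `mapSet_rmul`, `mem_rstab_mapSet_iff`);
* invariance of `redDim` under relabelling the four corners (`redDim_comp_perm`);
* a group of order 6 with a complex conjugation is cyclic, hence `≃* C6` with `c ↦ cc_C6` (adapted from p6's HOME file
  `proofs/p6/Classify6.lean`, `exists_mulEquiv_C6` — not landed, so re-proved here under the names `night4_…`);
* `redDim_faceCorners_of_card_six` — every census face `(Φ; p, p')` of any `(G, c)` of order 6 has `redDim = 4`;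
* `redDim_eq_four_of_sumTwo_six` — every `SumTwo` quadruple of CM types of any `(G, c)` of order 6 with no two corners
  conjugate has `redDim = 4` (the typer's `isFace_of_sumTwo_of_card_le_eight'` makes it a census face up to relabelling);
* `Route.TypeDatum.redDim_eq_four` — for every type datum `D` with `|G| = 6` and every face `Δ` of the roster
  (`IsFace`: four distinct corner types, (eq2), no two conjugate), `D.redDim Δ = 4`.

So the combinatorial half of ROUTE.md §3.2's count ("three primitive corners … and one k-lift corner … B_red = A × E, an
abelian FOURFOLD") is a KERNEL theorem for every degree-6 Galois CM field and every face; what stays the cell's is the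
dictionary `dim (reduced A Δ) = redDim` (`DimReduced`, `Night4ReducedDimRoute.lean`).  Nothing here says anything about
the status of the Hodge conjecture for CM abelian varieties, which is NOT proved.
-/

set_option autoImplicit false

open Finset
open scoped Pointwise symmDiff

namespace HodgeRepro

/-! ## Transport along a group isomorphism -/

section Transport

variable {G G' : Type} [Group G] [Group G'] [Fintype G] [Fintype G'] [DecidableEq G] [DecidableEq G']

omit [Fintype G] [Fintype G'] in
/-- Transport of a place: `e {p, c p} = {e p, e c · e p}`. -/
theorem mapSet_place (e : G ≃* G') (c p : G) : mapSet e (place c p) = place (e c) (e p) := by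
  ext x
  rw [mem_mapSet, mem_place, mem_place, MulEquiv.symm_apply_eq, MulEquiv.symm_apply_eq, map_mul]

omit [Fintype G] [Fintype G'] in
/-- Transport of a flip: `e (S ∆ {p, c p}) = e S ∆ {e p, e c · e p}`. -/
theorem mapSet_flipAt (e : G ≃* G') (c p : G) (S : Finset G) :
    mapSet e (flipAt c p S) = flipAt (e c) (e p) (mapSet e S) := by
  ext x
  rw [mem_mapSet, mem_flipAt, mem_flipAt, ← mapSet_place, mem_mapSet, mem_mapSet]

omit [Fintype G] [Fintype G'] in
/-- Transport of the four corners of a face. -/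
theorem mapSet_faceCorners (e : G ≃* G') (c : G) (Φ : Finset G) (p p' : G) (i : Fin 4) :
    mapSet e (faceCorners c Φ p p' i) = faceCorners (e c) (mapSet e Φ) (e p) (e p') i := by
  fin_cases i <;> simp only [faceCorners, mapSet_flipAt, mapSet_smul]

/-- Transport of a right-translation class: `rclass (e T) = e (rclass T)`. -/
theorem rclass_mapSet (e : G ≃* G') (T : Finset G) : rclass (mapSet e T) = (rclass T).image (mapSet e) := by
  unfold rclass
  rw [Finset.image_image]
  ext X
  simp only [mem_image, mem_univ, true_and, Function.comp, mapSet_rmul]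
  constructor
  · rintro ⟨h', rfl⟩
    exact ⟨e.symm h', by rw [MulEquiv.apply_symm_apply]⟩
  · rintro ⟨h, rfl⟩
    exact ⟨e h, rfl⟩

/-- The right stabiliser is transported: `|rstab (e T)| = |rstab T|`. -/
theorem card_rstab_mapSet (e : G ≃* G') (T : Finset G) :
    Fintype.card (rstab (mapSet e T)) = Fintype.card (rstab T) := by
  refine Fintype.card_congr (Equiv.subtypeEquiv e.toEquiv.symm fun a => ?_)
  show a ∈ rstab (mapSet e T) ↔ e.symm a ∈ rstab T
  conv_lhs => rw [← MulEquiv.apply_symm_apply e a]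
  exact mem_rstab_mapSet_iff e T (e.symm a)

/-- `simpleDim` is transported. -/
theorem simpleDim_mapSet (e : G ≃* G') (T : Finset G) : simpleDim (mapSet e T) = simpleDim T := by
  unfold simpleDim
  rw [card_rstab_mapSet, card_eq_of_mulEquiv e]

/-- `redDim` is transported. -/
theorem redDim_mapSet (e : G ≃* G') (T : Fin 4 → Finset G) :
    redDim (fun i => mapSet e (T i)) = redDim T := by
  unfold redDim
  simp only [rclass_mapSet, simpleDim_mapSet]
  have key : (univ.image fun i => ((rclass (T i)).image (mapSet e), simpleDim (T i))) =
      (univ.image fun i => (rclass (T i), simpleDim (T i))).image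
        (fun q : Finset (Finset G) × ℕ => (q.1.image (mapSet e), q.2)) := by
    rw [Finset.image_image]
    rfl
  rw [key, Finset.sum_image]
  intro x _ y _ h
  have h1 := congrArg Prod.fst h
  have h2 := congrArg Prod.snd h
  simp only at h1 h2
  exact Prod.ext (Finset.image_injective (mapSet_injective e) h1) h2

end Transport

/-! ## Relabelling the corners -/

section Relabel

variable {G : Type} [Group G] [Fintype G] [DecidableEq G]

/-- `redDim` does not see the order of the four corners. -/
theorem redDim_comp_perm (T : Fin 4 → Finset G) (σ : Equiv.Perm (Fin 4)) : redDim (T ∘ σ) = redDim T := by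
  unfold redDim
  congr 1
  have : (univ.image fun i => (rclass ((T ∘ σ) i), simpleDim ((T ∘ σ) i))) =
      (univ.image σ).image fun i => (rclass (T i), simpleDim (T i)) := by
    rw [Finset.image_image]
    rfl
  rw [this, Finset.image_univ_of_surjective σ.surjective]

end Relabel

/-! ## Groups of order 6 with a complex conjugation are cyclic (adapted from p6's `Classify6.lean`, HOME, not landed) -/

section Six

variable {G : Type} [Group G] [Fintype G]

omit [Fintype G] in
/-- A complex conjugation has order exactly `2`. -/
theorem night4_orderOf_eq_two {c : G} (hc : IsComplexConj c) : orderOf c = 2 := by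
  rw [orderOf_eq_prime_iff]
  exact ⟨by rw [pow_two, hc.mul_self], hc.ne_one⟩

/-- A group of order `6` with a central involution is cyclic (Cauchy gives `b` of order `3`; `c * b` has order `6`). -/
theorem night4_isCyclic_of_card_six {c : G} (h6 : Fintype.card G = 6) (hc : IsComplexConj c) : IsCyclic G := by
  haveI : Fact (Nat.Prime 3) := ⟨by norm_num⟩
  obtain ⟨b, hb⟩ := exists_prime_orderOf_dvd_card 3 (by rw [h6]; norm_num)
  have hcomm : Commute c b := hc.comm b
  have h := hcomm.orderOf_mul_eq_mul_orderOf_of_coprime (by rw [night4_orderOf_eq_two hc, hb]; norm_num)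
  rw [night4_orderOf_eq_two hc, hb] at h
  exact isCyclic_of_orderOf_eq_card (c * b) (by rw [h, Nat.card_eq_fintype_card, h6])

/-- The only element of order `2` of `C6` is `cc_C6`. -/
theorem night4_C6_eq_cc_of_orderOf_eq_two {x : C6} (hx : orderOf x = 2) : x = cc_C6 := by
  have hx2 : x * x = 1 := by rw [← pow_two, ← hx, pow_orderOf_eq_one]
  have hx1 : x ≠ 1 := by
    intro h1
    rw [h1, orderOf_one] at hx
    exact absurd hx (by norm_num)
  clear hx
  revert x
  decide

/-- **Every `(G, c)` of order 6 is `(C6, cc_C6)`**: an isomorphism `e : G ≃* C6` with `e c = cc_C6`. -/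
theorem night4_exists_mulEquiv_C6 {c : G} (h6 : Fintype.card G = 6) (hc : IsComplexConj c) :
    ∃ e : G ≃* C6, e c = cc_C6 := by
  haveI : IsCyclic G := night4_isCyclic_of_card_six h6 hc
  haveI : IsCyclic C6 := inferInstance
  let e : G ≃* C6 := mulEquivOfCyclicCardEq (by
    rw [Nat.card_eq_fintype_card, Nat.card_eq_fintype_card, h6, card_C6])
  refine ⟨e, night4_C6_eq_cc_of_orderOf_eq_two ?_⟩
  rw [MulEquiv.orderOf_eq e c]
  exact night4_orderOf_eq_two hc

end Six

/-! ## Degree 6 in general -/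

section General

variable {G : Type} [Group G] [Fintype G] [DecidableEq G]

/-- **Every census face of any degree-6 `(G, c)` has `redDim = 4`**: transport to `C6` and `redDim_faceCorners_C6`. -/
theorem redDim_faceCorners_of_card_six {c : G} (h6 : Fintype.card G = 6) (hc : IsComplexConj c) {Φ : Finset G}
    (hΦ : IsCMType c Φ) {p p' : G} (hp : p' ∉ place c p) : redDim (faceCorners c Φ p p') = 4 := by
  obtain ⟨e, hec⟩ := night4_exists_mulEquiv_C6 h6 hc
  rw [← redDim_mapSet e]
  have hface : (fun i => mapSet e (faceCorners c Φ p p' i)) = faceCorners cc_C6 (mapSet e Φ) (e p) (e p') := by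
    funext i
    rw [mapSet_faceCorners, hec]
  rw [hface]
  refine redDim_faceCorners_C6 _ _ _ ?_ ?_
  · rw [← hec]
    exact hΦ.map e
  · rw [← hec, ← mapSet_place, mem_mapSet, MulEquiv.symm_apply_apply]
    exact hp

/-- **Every `SumTwo` quadruple of CM types of a degree-6 `(G, c)` with no two corners conjugate has `redDim = 4`** — it is a
census face up to relabelling (the typer's `isFace_of_sumTwo_of_card_le_eight'`). -/
theorem redDim_eq_four_of_sumTwo_six {c : G} (h6 : Fintype.card G = 6) (hc : IsComplexConj c) {T : Fin 4 → Finset G}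
    (hT : ∀ i, IsCMType c (T i)) (hsum : SumTwo T) (hconj : ∀ i j, i ≠ j → T j ≠ c • T i) : redDim T = 4 := by
  obtain ⟨a, b, d, π, π', ha, hb, hd, hab, had, hbd, -, -, hpl, h1, h2, h3⟩ :=
    isFace_of_sumTwo_of_card_le_eight' hc hT hsum hconj (by omega)
  let σ : Fin 4 → Fin 4 := ![0, a, b, d]
  have hσ : Function.Bijective σ := by
    refine (Fintype.bijective_iff_injective_and_card σ).2 ⟨?_, rfl⟩
    intro i j hij
    fin_cases i <;> fin_cases j <;> simp [σ] at hij ⊢ <;> omega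
  have hTσ : T ∘ σ = faceCorners c (T 0) π π' := by
    funext i
    fin_cases i <;> simp [σ, faceCorners, h1, h2, h3]
  rw [← redDim_comp_perm T (Equiv.ofBijective σ hσ)]
  change redDim (T ∘ σ) = 4
  rw [hTσ]
  exact redDim_faceCorners_of_card_six h6 hc (hT 0) hpl

end General

namespace Route

/-- **ROUTE.md §3.2's count for every face of every degree-6 type datum**: `D.redDim Δ = 4` whenever `|G| = 6` and `Δ` is a
face of the roster (`IsFace`: `|Δ| = 4`, (eq2) at `p = 2`, pairwise distinct corner types, no two conjugate). -/
theorem TypeDatum.redDim_eq_four (D : TypeDatum) (h6 : Fintype.card D.G = 6) (Δ : Finset D.S) (hΔ : D.IsFace Δ) :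
    D.redDim Δ = 4 := by
  obtain ⟨hcard, heq2, -, hconj⟩ := hΔ
  have hc4 : Fintype.card Δ = 4 := by rw [Fintype.card_coe, hcard]
  let e : Fin 4 ≃ Δ := (Fintype.equivFinOfCardEq hc4).symm
  let T : Fin 4 → Finset D.G := fun i => D.liftedType (e i).1
  have hT : D.redDim Δ = HodgeRepro.redDim T := by
    unfold TypeDatum.redDim HodgeRepro.redDim
    congr 1
    ext x
    simp only [mem_image, mem_univ, true_and]
    constructor
    · rintro ⟨s, hs, rfl⟩
      exact ⟨e.symm ⟨s, hs⟩, by simp [T]⟩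
    · rintro ⟨i, rfl⟩
      exact ⟨(e i).1, (e i).2, rfl⟩
  rw [hT]
  refine redDim_eq_four_of_sumTwo_six h6 D.hc (fun i => D.liftedType_isCMType _) ?_ ?_
  · intro t
    rw [← heq2.sum_liftedType_eq D t]
    refine Finset.card_bij (fun i _ => (e i).1) ?_ ?_ ?_
    · intro i hi
      simp only [mem_filter, mem_univ, true_and] at hi ⊢
      exact ⟨(e i).2, hi⟩
    · intro i _ j _ h
      exact e.injective (Subtype.ext h)
    · intro s hs
      simp only [mem_filter] at hs
      exact ⟨e.symm ⟨s, hs.1⟩, by simp [mem_filter, T, hs.2], by simp⟩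
  · intro i j _
    exact hconj _ (e i).2 _ (e j).2

end Route

end HodgeRepro
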